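import Mathlib.Algebra.CharP.Lemmas
import Mathlib.Algebra.Ring.GeomSum
import Mathlib.Algebra.Polynomial.AlgebraMap
import Mathlib.FieldTheory.Finite.Basic
import Mathlib.GroupTheory.OrderOfElement
import Mathlib.RingTheory.Polynomial.Basic
import HarnessLib

/-!
# Fukuda's Nakayama step at finite level: a `φ`-stable subgroup `Y` of a finite abelian `p`-group with
# `N_φ(Y) = Y`, `N_φ = 1 + φ + ⋯ + φ^{p-1}`, `φ^{p^k} = 1`, is trivial (Fukuda 1994, proof of Thm. 1; Washington Lemma 13.16)

Topic `NumberTheory/IwasawaTheory` (namespace = path). THEOREM-ONLY file (no definition, no named fact, no `sorry`), written by the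
prover seat `bsd-potss-k8t-c4` g19 (cell `bsd-potss`; supports stmt-BirchSwinnertonDyer-19982 via the Fukuda road; closes nothing).
It is brick (N) of the finite-level proof of the named fact `fukuda1994_thm1_classNumberPExp_const_of_succ_eq`
(`IwasawaTheory/ClassicalMuInvariant.lean` §5, no `_holds` yet) planned in the seat memo
`run/shared/lean/pub/bsd-potss/k8t-c4/g19/SCOPE-fukuda1994-thm1-holds-k8t-c4-g19.md`: with `H_p` the `p`-Hilbert class field of
`K_{n+2}`, `A = Gal(H_p/K_{n+2})`, `φ` = conjugation by a generator of a totally ramified inertia group and `Y ≤ A` the subgroup with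
`p^{e_n} = [A : Y]`, `p^{e_{n+1}} = [A : N_φ Y]`, the hypothesis `e_{n+1} = e_n` forces `N_φ Y = Y`, and THIS file concludes `Y = 1`,
whence `e_{n+2} = e_{n+1}`. In print the step is «`ν_{0,1} Y = Y`; `ν_{0,1}` is contained in the maximal ideal `(p, T)` of `Λ` and `Y` is
finitely generated over `Λ`; hence `Y = 0` from Nakayama's lemma» (Fukuda 1994 p. 264; Washington §13.3 Lemma 13.16 / proof of
Prop. 13.22). At finite level no `Λ` is needed: the POLYNOMIAL IDENTITY
`(1 + X + ⋯ + X^{p-1})^{p^k} = p·T(X) + (X^{p^k} − 1)·(X − 1)^{(p−2)p^k}` in `ℤ[X]` (§1; reduce mod `p`, where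
`1 + X + ⋯ + X^{p−1} = (X − 1)^{p−1}` and `X^{p^k} − 1 = (X − 1)^{p^k}`) gives `N_φ^{p^k} = p·T(φ)` on any `ℤ[φ]`-module killed by
`φ^{p^k} − 1` (§2), so `Y = N_φ^{p^k} Y ⊆ pY`, and a subgroup of a finite abelian `p`-group with `Y ⊆ pY` is trivial (§3).

References: [Fukuda1994] T. Fukuda, *Remarks on ℤ_p-extensions of number fields*, Proc. Japan Acad. 70 A (1994), Thm. 1 and its proof,
p. 264; [Washington1997] L. Washington, *Introduction to Cyclotomic Fields*, 2nd ed., §13.3, Lemmas 13.14–13.16, Prop. 13.22.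
-/

noncomputable section

open Polynomial Finset

namespace Literature.NumberTheory.IwasawaTheory.FukudaNakayama

/-! ## §1 The polynomial identity in `ℤ[X]` -/

/-- In `𝔽_p[X]`: `1 + X + ⋯ + X^{p−1} = (X − 1)^{p−1}` (both times `X − 1` give `X^p − 1 = (X − 1)^p`). [cite: Washington1997, §13.3 (proof of Lemma 13.16)] -/
theorem geom_sum_eq_sub_one_pow (p : ℕ) [hp : Fact p.Prime] :
    (∑ i ∈ range p, (X : (ZMod p)[X]) ^ i) = (X - 1) ^ (p - 1) := by
  have hX1 : (X : (ZMod p)[X]) - 1 ≠ 0 := X_sub_C_ne_zero 1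
  apply mul_right_cancel₀ hX1
  rw [geom_sum_mul, ← pow_succ, Nat.sub_add_cancel hp.out.one_le, sub_pow_char, one_pow]

/-- **The identity `(1 + X + ⋯ + X^{p−1})^{p^k} = p·T + (X^{p^k} − 1)(X − 1)^{(p−2)p^k}` in `ℤ[X]`** for some `T ∈ ℤ[X]`: modulo `p` the
left side is `(X − 1)^{(p−1)p^k} = (X − 1)^{p^k}·(X − 1)^{(p−2)p^k}` and `(X − 1)^{p^k} = X^{p^k} − 1`.
[cite: Fukuda1994, p. 264 (proof of Thm. 1: `ν_{0,1} ∈ (p, T)`)] [cite: Washington1997, §13.3 Lemma 13.16] -/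
theorem exists_geom_sum_pow_eq (p k : ℕ) [hp : Fact p.Prime] :
    ∃ T : ℤ[X], (∑ i ∈ range p, (X : ℤ[X]) ^ i) ^ (p ^ k) =
      C (p : ℤ) * T + (X ^ (p ^ k) - 1) * (X - 1) ^ ((p - 2) * p ^ k) := by
  set f : ℤ[X] := (∑ i ∈ range p, (X : ℤ[X]) ^ i) ^ (p ^ k) - (X ^ (p ^ k) - 1) * (X - 1) ^ ((p - 2) * p ^ k)
    with hf
  -- `f ≡ 0 (mod p)` coefficientwise
  have hmap : f.map (Int.castRingHom (ZMod p)) = 0 := by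
    rw [hf, Polynomial.map_sub, Polynomial.map_pow, Polynomial.map_sum]
    simp only [Polynomial.map_pow, Polynomial.map_X, Polynomial.map_mul, Polynomial.map_sub, Polynomial.map_one]
    have h1 : (X : (ZMod p)[X]) ^ p ^ k - 1 = (X - 1) ^ p ^ k := by rw [sub_pow_char_pow, one_pow]
    have h2 : (p - 1) * p ^ k = p ^ k + (p - 2) * p ^ k := by
      have : p - 1 = (p - 2) + 1 := by have := hp.out.two_le; omega
      rw [this]; ring
    rw [geom_sum_eq_sub_one_pow p, h1, ← pow_mul, ← pow_add, h2, sub_self]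
  have hdvd : C (p : ℤ) ∣ f := by
    rw [C_dvd_iff_dvd_coeff]
    intro i
    have hi : (Int.castRingHom (ZMod p)) (f.coeff i) = 0 := by
      rw [← Polynomial.coeff_map, hmap, coeff_zero]
    exact (ZMod.intCast_zmod_eq_zero_iff_dvd _ _).mp hi
  obtain ⟨T, hT⟩ := hdvd
  refine ⟨T, ?_⟩
  rw [← hT, hf]
  ring

/-! ## §2 `N_φ^{p^k} = p·T(φ)` for an endomorphism with `φ^{p^k} = 1` -/

/-- **`(1 + φ + ⋯ + φ^{p−1})^{p^k} = p·T(φ)`** for an endomorphism `φ` of an additive commutative group with `φ^{p^k} = 1`, `T` the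
polynomial of `exists_geom_sum_pow_eq` evaluated at `φ`. [cite: Fukuda1994, p. 264] [cite: Washington1997, §13.3 Lemma 13.16] -/
theorem exists_geom_sum_pow_eq_smul {M : Type*} [AddCommGroup M] (p k : ℕ) [Fact p.Prime] (φ : Module.End ℤ M)
    (hφ : φ ^ (p ^ k) = 1) :
    ∃ T : ℤ[X], (∑ i ∈ range p, φ ^ i) ^ (p ^ k) = (p : ℤ) • aeval φ T := by
  obtain ⟨T, hT⟩ := exists_geom_sum_pow_eq p k
  refine ⟨T, ?_⟩
  have h := congrArg (aeval φ) hT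
  rw [map_pow, map_sum] at h
  simp_rw [map_pow, aeval_X] at h
  rw [map_add, map_mul, map_mul, aeval_C, map_sub, map_pow, aeval_X, map_one, hφ, sub_self, zero_mul, add_zero,
    ← Algebra.smul_def] at h
  exact h

/-- A `φ`-stable submodule is stable under every polynomial in `φ` (auxiliary). [folklore] -/
private theorem aeval_apply_mem_of_forall_mem {M : Type*} [AddCommGroup M] (φ : Module.End ℤ M) (Y : Submodule ℤ M)
    (hY : ∀ y ∈ Y, φ y ∈ Y) (q : ℤ[X]) {y : M} (hy : y ∈ Y) : aeval φ q y ∈ Y := by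
  induction q using Polynomial.induction_on' with
  | add q r hq hr => rw [map_add, LinearMap.add_apply]; exact Y.add_mem hq hr
  | monomial n a =>
    rw [← C_mul_X_pow_eq_monomial, map_mul, map_pow, aeval_C, aeval_X, Module.End.mul_apply, algebraMap_int_eq,
      eq_intCast, Module.End.intCast_apply]
    refine Y.smul_mem _ ?_
    induction n with
    | zero => simpa using hy
    | succ n ih => rw [pow_succ', Module.End.mul_apply]; exact hY _ ih

/-! ## §3 The Nakayama step -/

/-- **A subgroup of a finite abelian `p`-group contained in its own `p`-multiples is trivial** (`Y ⊆ pY ⇒ Y ⊆ p^jY` for all `j`, and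
`#M • y = 0`) — the finite-group shadow of Nakayama's lemma «`Y = (p,T)Y ⇒ Y = 0`» used by Fukuda and Washington.
[cite: Washington1997, §13.3 Lemma 13.16] [cite: Fukuda1994, p. 264 (proof of Thm. 1)] -/
theorem eq_bot_of_le_smul {M : Type*} [AddCommGroup M] [Finite M] {p : ℕ} (hM : ∃ a : ℕ, Nat.card M = p ^ a)
    (Y : Submodule ℤ M) (hY : ∀ y ∈ Y, ∃ y' ∈ Y, y = (p : ℤ) • y') : Y = ⊥ := by
  obtain ⟨a, ha⟩ := hM
  have hpow : ∀ j : ℕ, ∀ y ∈ Y, ∃ y' ∈ Y, y = ((p : ℤ) ^ j) • y' := by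
    intro j
    induction j with
    | zero => intro y hy; exact ⟨y, hy, by rw [pow_zero, one_smul]⟩
    | succ j ih =>
      intro y hy
      obtain ⟨y₁, hy₁, rfl⟩ := ih y hy
      obtain ⟨y₂, hy₂, rfl⟩ := hY y₁ hy₁
      exact ⟨y₂, hy₂, by rw [smul_smul, ← pow_succ]⟩
  rw [eq_bot_iff]
  intro y hy
  obtain ⟨y', -, rfl⟩ := hpow a y hy
  rw [Submodule.mem_bot, ← Nat.cast_pow, natCast_zsmul, ← ha]
  exact card_nsmul_eq_zero'

/-- **Fukuda's Nakayama step (finite level).** Let `M` be a finite abelian `p`-group, `φ` an endomorphism of `M` with `φ^{p^k} = 1`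
(e.g. the conjugation action of a generator of `Gal(K_{n+2}/K_n)` on `Gal(H_p/K_{n+2})`), and `Y ≤ M` a `φ`-stable subgroup with
`Y ⊆ N_φ(Y)`, `N_φ = 1 + φ + ⋯ + φ^{p−1}`. Then `Y = 0`: `N_φ^{p^k} = p·T(φ)` (§1–§2) gives `Y ⊆ N_φ^{p^k} Y ⊆ pY`, and §3 concludes.
This replaces «`ν_{0,1}Y = Y`, `ν_{0,1} ∈ (p, T)`, Nakayama over `Λ`» of the printed proof. [cite: Fukuda1994, Thm. 1 (1), p. 264 (proof)]
[cite: Washington1997, §13.3 Lemma 13.16, Prop. 13.22] -/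
theorem eq_bot_of_le_map_geom_sum {M : Type*} [AddCommGroup M] [Finite M] {p : ℕ} [Fact p.Prime] (k : ℕ)
    (hM : ∃ a : ℕ, Nat.card M = p ^ a) (φ : Module.End ℤ M) (hφ : φ ^ (p ^ k) = 1) (Y : Submodule ℤ M)
    (hstab : ∀ y ∈ Y, φ y ∈ Y) (hN : ∀ y ∈ Y, ∃ y' ∈ Y, y = (∑ i ∈ range p, φ ^ i) y') : Y = ⊥ := by
  set N : Module.End ℤ M := ∑ i ∈ range p, φ ^ i with hNdef
  -- `Y ⊆ N^j Y` for every `j`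
  have hiter : ∀ j : ℕ, ∀ y ∈ Y, ∃ y' ∈ Y, y = (N ^ j) y' := by
    intro j
    induction j with
    | zero => intro y hy; exact ⟨y, hy, by rw [pow_zero, Module.End.one_apply]⟩
    | succ j ih =>
      intro y hy
      obtain ⟨y₁, hy₁, rfl⟩ := ih y hy
      obtain ⟨y₂, hy₂, rfl⟩ := hN y₁ hy₁
      exact ⟨y₂, hy₂, by rw [pow_succ, Module.End.mul_apply]⟩
  obtain ⟨T, hT⟩ := exists_geom_sum_pow_eq_smul p k φ hφ
  refine eq_bot_of_le_smul hM Y fun y hy => ?_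
  obtain ⟨y', hy', rfl⟩ := hiter (p ^ k) y hy
  refine ⟨aeval φ T y', aeval_apply_mem_of_forall_mem φ Y hstab T hy', ?_⟩
  rw [← hNdef] at hT
  rw [hT, LinearMap.smul_apply]

end Literature.NumberTheory.IwasawaTheory.FukudaNakayama

end
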